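import Literature.MathematicalPhysics.QuantumFieldTheory.ContinuumLimitsTrivialityPrintedInputProofs
import Literature.Probability.LatticeModels.FieldScalingLimitTrivialityProofs
import Literature.Probability.LatticeModels.HighDimTrivialityCorrLengthWindow
import HarnessLib

/-!
# constructive-qft.S24 reduced to the printed estimates: the core in any dimension, `φ⁴_d` (`d ≥ 5`) from Panis's Thm 5.5, Ising₄ from ADC Thm 1.3

Sibling proofs file of `Literature/MathematicalPhysics/QuantumFieldTheory/ContinuumLimits.lean`
(constructive-qft.S24: `phi44_triviality`, `ising4_triviality`, `phi4_highDim_triviality`),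
continuing `ContinuumLimitsTrivialityPrintedInputProofs.lean` (which proves
`phi44_triviality_of_prop72`, `d = 4`). Theorems only: **no statement of the tree is changed, no
definition and no named fact is introduced** (D-0026).

* `exists_scale_of_mgfBound` — the reduction of `…PrintedInputProofs` made model-independent in
  the dimension `d` and in the "printed regime": given couplings `0 ≤ J(δ) ≤ J_c`, the
  thermodynamic limits in law `ν_δ` of the free-boundary `φ⁴` box laws at mesh `δ`, a window
  predicate `W J L` holding eventually at `(J(δ), (Mδ)⁻¹)` (`M ≥ 1`), an exponential-moment bound
  of the common printed shape `|⟨e^{zT_{f,L}}⟩ - e^{z²⟨T²_{f,L}⟩/2}| ≤ e^{z²⟨T²_{|f|,L}⟩/2} A_f z⁴ k_f(L)`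
  with `k_f(L) → 0` in the regime (Aizenman–Duminil-Copin 2021 Prop. 7.2 in proof form:
  `k = (log L)^{-c}`; Panis 2023 Thm 5.5: `k = L^{-(d-4)}`; Panis Cor. 8.2: `k = (log L)^{-c}`,
  `A = C ‖f‖_∞⁴ r_f^γ`) and the two-sided variance bounds (ADC p. 6; Panis §1.2.1 fn. 3), all for
  the free-boundary infinite-volume state as box limits (`phi4BoxExpect`, `HasBoxLimit`) and the
  normalised field `phi4NormalizedField`, it produces the scale data consumed by
  `phi44_triviality_of_scaleBound` / `phi4_highDim_triviality_of_scaleBound`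
  (`ContinuumLimitsTrivialityAssemblyProofs`): identification of `ν_δ` with the box limits
  (`integral_exp_eval_eq_of_thermodynamicLimit`, `integral_sq_eval_eq_of_thermodynamicLimit`),
  dilation `f ↦ f(·/M)`, normalisation `s(δ) = (ρ(δ) δᵈ Σ_L^{1/2})²`.
* `phi4_highDim_triviality_of_thm55` — **`phi4_highDim_triviality` (`d ≥ 5`) follows from Panis
  2023, Thm 5.5 (with Rem. 5.7 / §8 for the Griffiths–Simon class, containing lattice `φ⁴` by
  Prop. 2.2; originally Aizenman 1982 Prop. 10.1 / §13, Fröhlich 1982) and the variance bounds,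
  stated at the level of the printed objects** — window `W J L := J₀ ≤ J`, `M = 1`,
  `k(L) = L^{-(d-4)}`, the printed constant `C (β⁻⁴ ∨ β⁻²)` being non-increasing in `β ≥ β₀`.
* `ising4_triviality_of_adcUrsellFourSum`, `ising4_triviality_of_improvedTreeDiagramBound`,
  `ising4_triviality_of_panisFour` — **`ising4_triviality` follows from ADC Thm 1.3 alone**
  (`Literature.Probability.LatticeModels.aizenmanDuminilCopin_improvedTreeDiagramBound`; the
  §6.3 summation with the proved sliding-scale infrared bound Thm 5.6 is
  `aizenmanDuminilCopin_ursellFourSum_le_of_facts`), or from Panis 2023 Cor. 1.8 alone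
  (`panis_ursellFourSum_le_four`): the crit-ising law-level theorem
  `Literature.Probability.LatticeModels.isGaussianField_of_tendstoInLaw_spinFieldLaw_gibbs`
  (`FieldScalingLimitTrivialityProofs`) has exactly the shape of `ising4_triviality` — zero-field
  DLR states, smearing boxes with `δ L(δ) → ∞`, any `β(δ) ∈ [0, β_c]` — its window hypothesis
  `L ≤ M ξ(β)` and the a-posteriori `HasBoundedNondegenerateTwoPoint μ` being unnecessary
  (uniformity in `β ≤ β_c` is derived in the tree, `HighDimTrivialityUniformProofs`).

What is NOT here: the printed estimates themselves (Panis Thm 5.5 / ADC Prop. 7.2 for lattice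
`φ⁴`, the `φ⁴` variance bounds; ADC Thm 1.3), hence none of `phi4_highDim_triviality_holds`,
`phi44_triviality_holds`, `ising4_triviality_holds`.

## References

* R. Panis, *Triviality of the scaling limits of critical Ising and `φ⁴` models with effective
  dimension at least four*, arXiv:2309.05797 (held; arXiv numbering), Ann. Probab. 54 (2026):
  Thm 5.5 (p. 21), Rem. 5.7 (p. 22), Prop. 2.2 (p. 12), §1.2.1 fn. 3 (p. 6), Cor. 1.8, Thm 8.1 /
  Cor. 8.2 (p. 42) [Panis2023Triviality].
* M. Aizenman, H. Duminil-Copin, Ann. Math. 194 (2021), arXiv:1912.07973 (held): Thm 1.2, Thm 1.3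
  (p. 6), Prop. 1.4, Thm 5.6, §6.3, Prop. 7.2, p. 6 [AizenmanDuminilCopinAnnals2021].
* M. Aizenman, *Geometric analysis of `φ⁴` fields and Ising models I, II*, Comm. Math. Phys. 86
  (1982) 1–48: Prop. 10.1 (p. 28), §13 (pp. 39–41) [AizenmanCMP1982] (not held; as quoted in the
  docstring of `phi4_highDim_triviality` and by Panis §1).
-/

noncomputable section

open scoped SchwartzMap NNReal
open MeasureTheory Filter Topology ProbabilityTheory
open Literature.MathematicalPhysics.QuantumLattice (FieldConfig TendstoInLaw phi4BoxMeasure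
  phi4CriticalJ phi4TwoPoint latticeFieldLaw siteToE)
open Literature.Probability.LatticeModels (box latticeBox HasBoxLimit invCorrLength
  cube_of_comp_inv_smul exists_cube_of_hasCompactSupport
  isGaussianField_of_tendstoInLaw_spinFieldLaw_gibbs ursellFourSum_uniformlySmall_of_adc
  ursellFourSum_uniformlySmall_of_panis_four aizenmanDuminilCopin_ursellFourSum_le
  aizenmanDuminilCopin_ursellFourSum_le_of_facts aizenmanDuminilCopin_improvedTreeDiagramBound
  aizenmanDuminilCopin_slidingScaleInfraredBound_holds panis_ursellFourSum_le_four)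
open Literature.Probability.LatticeModels renaming Site → LSite

namespace Literature.MathematicalPhysics.QuantumFieldTheory

variable {d : ℕ}

/-! ### The model-independent core in any dimension: from an exponential-moment bound under a
window predicate to the scale data of `…_of_scaleBound` -/

/-- **Core of the reduction, any dimension `d`, abstract window.** Fix `g > 0`, `κ`, couplings
`0 ≤ J(δ) ≤ J_c` and the thermodynamic limits in law `ν_δ` of the free-boundary box laws at mesh
`δ` (the approximants of the restated `phi44_triviality` / `phi4_highDim_triviality`). Let
`W J L` be a "printed regime" predicate holding eventually at `(J(δ), L(δ))`, `L(δ) = (M δ)⁻¹`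
(`M ≥ 1`). Suppose that for every `r ≥ 1` and continuous `f` vanishing outside `[-r, r]ᵈ` there
are a constant `A` and a rate `k(L) → 0` (`L → ∞`) such that in the regime `W J' L`, `J' ≤ J_c`,
`L > 1`, the infinite-volume box limits `m = ⟨e^{zT_{f,L}}⟩`, `v = ⟨T²_{f,L}⟩`, `v' = ⟨T²_{|f|,L}⟩`
exist and `|m - e^{z² v/2}| ≤ e^{z² v'/2} · A z⁴ k(L)` for all real `z` (the common shape of ADC
2021 Prop. 7.2 in proof form, Panis 2023 Thm 5.5 and Cor. 8.2), and that the variance bounds of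
ADC p. 6 / Panis §1.2.1 fn. 3 hold. Then the scale data required by
`phi44_triviality_of_scaleBound` / `phi4_highDim_triviality_of_scaleBound` exist, with
`s(δ) = (ρ(δ) δᵈ Σ_L^{1/2})²`. [cite: AizenmanDuminilCopinAnnals2021, Thm 1.2 from Prop. 7.2 and p. 6] -/
theorem exists_scale_of_mgfBound {g κ : ℝ} (hg : 0 < g) {J ρ : ℝ → ℝ}
    {ν : ℝ → Measure (FieldConfig (EuclideanSpace ℝ (Fin d)))}
    (hJ : ∀ δ, 0 < δ → 0 ≤ J δ ∧ J δ ≤ phi4CriticalJ d g κ)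
    (hν : ∀ δ, 0 < δ → TendstoInLaw (fun R : ℕ =>
      latticeFieldLaw (phi4BoxMeasure d R g κ (J δ)) (box d R) δ (ρ δ)) atTop (ν δ))
    {W : ℝ → ℝ → Prop} {M : ℝ} (hM1 : 1 ≤ M) (hW : ∀ᶠ δ in 𝓝[>] (0 : ℝ), W (J δ) (M * δ)⁻¹)
    (hmgf : ∀ r : ℝ, 1 ≤ r → ∀ f : EuclideanSpace ℝ (Fin d) → ℝ, Continuous f →
      (∀ x, f x ≠ 0 → ∀ i, |x i| ≤ r) →
      ∃ (A : ℝ) (k : ℝ → ℝ), Tendsto k atTop (𝓝 0) ∧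
      ∀ (J' L : ℝ), 0 ≤ J' → J' ≤ phi4CriticalJ d g κ → W J' L → 1 < L →
      ∀ z : ℝ, ∃ m v v' : ℝ,
        HasBoxLimit (phi4BoxExpect d g κ J' fun φ =>
          Real.exp (z * phi4NormalizedField d g κ J' L f φ)) m ∧
        HasBoxLimit (phi4BoxExpect d g κ J' fun φ => phi4NormalizedField d g κ J' L f φ ^ 2) v ∧
        HasBoxLimit (phi4BoxExpect d g κ J' fun φ =>
          phi4NormalizedField d g κ J' L (fun x => |f x|) φ ^ 2) v' ∧
        |m - Real.exp (z ^ 2 / 2 * v)| ≤ Real.exp (z ^ 2 / 2 * v') * (A * z ^ 4 * k L))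
    (hvar : ∀ f : EuclideanSpace ℝ (Fin d) → ℝ, Continuous f → HasCompactSupport f →
      (∃ C : ℝ, ∀ (J' L : ℝ), 0 ≤ J' → J' ≤ phi4CriticalJ d g κ → 1 ≤ L →
        ∃ v : ℝ, HasBoxLimit (phi4BoxExpect d g κ J' fun φ =>
          phi4NormalizedField d g κ J' L f φ ^ 2) v ∧ v ≤ C) ∧
      ((∀ x, 0 ≤ f x) → f ≠ 0 → ∃ c L₀ : ℝ, 0 < c ∧
        ∀ (J' L : ℝ), 0 ≤ J' → J' ≤ phi4CriticalJ d g κ → L₀ ≤ L →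
        ∃ v : ℝ, HasBoxLimit (phi4BoxExpect d g κ J' fun φ =>
          phi4NormalizedField d g κ J' L f φ ^ 2) v ∧ c ≤ v)) :
    ∃ s : ℝ → ℝ, (∀ᶠ δ in 𝓝[>] (0 : ℝ), 0 ≤ s δ) ∧
      (∃ (f₀ : 𝓢(EuclideanSpace ℝ (Fin d), ℝ)) (c : ℝ), HasCompactSupport f₀ ∧ 0 < c ∧
        ∀ᶠ δ in 𝓝[>] (0 : ℝ), c * s δ ≤ ∫ ω, (ω f₀) ^ 2 ∂ν δ) ∧
      ∀ f : 𝓢(EuclideanSpace ℝ (Fin d), ℝ), HasCompactSupport f →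
        ∃ (K : ℝ → ℝ) (G : ℝ → ℝ), Tendsto K (𝓝[>] 0) (𝓝 0) ∧ MonotoneOn G (Set.Ici 0) ∧
          (∀ᶠ δ in 𝓝[>] (0 : ℝ), ∀ w : ℝ,
            Integrable (fun ω : FieldConfig (EuclideanSpace ℝ (Fin d)) =>
              Real.exp (w * ω f)) (ν δ)) ∧
          ∀ᶠ δ in 𝓝[>] (0 : ℝ), ∀ w : ℝ,
            |(∫ ω, Real.exp (w * ω f) ∂ν δ) -
                Real.exp (w ^ 2 * (∫ ω, (ω f) ^ 2 ∂ν δ) / 2)| ≤ K δ * G (s δ * w ^ 2) := by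
  have hM0 : 0 < M := one_pos.trans_le hM1
  -- the printed scale `L(δ) = (M δ)⁻¹` and the normalisation `a(δ) = ρ(δ) δᵈ Σ_L^{1/2}`
  obtain ⟨L, hL⟩ : ∃ L : ℝ → ℝ, ∀ δ, L δ = (M * δ)⁻¹ := ⟨_, fun _ => rfl⟩
  obtain ⟨a, ha⟩ : ∃ a : ℝ → ℝ, ∀ δ,
      a δ = ρ δ * δ ^ d * Real.sqrt (phi4BlockVariance d g κ (J δ) (L δ)) := ⟨_, fun _ => rfl⟩
  have hLtop : Tendsto L (𝓝[>] 0) atTop := by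
    rw [show L = fun δ => (M * δ)⁻¹ from funext hL]
    exact tendsto_inv_nhdsGT_zero.comp (tendsto_const_mul_nhdsGT_zero hM0)
  have hδpos : ∀ᶠ δ in 𝓝[>] (0 : ℝ), 0 < δ := eventually_mem_nhdsWithin
  have hW' : ∀ᶠ δ in 𝓝[>] (0 : ℝ), W (J δ) (L δ) := hW.mono fun δ h => by rwa [hL]
  -- the bump `f₀` and its dilate `f₀(·/M)`; lower variance bound ⇒ `Σ_L^{1/2} ≠ 0`
  obtain ⟨f₀, hf₀s, hf₀nn, hf₀0, hf₀cube⟩ := exists_schwartz_cubeBump d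
  set f₀M : EuclideanSpace ℝ (Fin d) → ℝ := fun y => f₀ (M⁻¹ • y) with hf₀M
  have hf₀Mc : Continuous f₀M := continuous_dilate f₀.continuous M
  have hf₀Ms : HasCompactSupport f₀M := hasCompactSupport_dilate hf₀s hM0.ne'
  have hf₀Mcube : ∀ x, f₀M x ≠ 0 → ∀ i, |x i| ≤ M * 2 := cube_of_comp_inv_smul hf₀cube hM0
  have hf₀Mnn : ∀ x, 0 ≤ f₀M x := fun x => hf₀nn _
  have hf₀Mne : f₀M ≠ 0 := fun h => by
    have h0 := congr_fun h 0
    simp only [hf₀M, smul_zero, hf₀0, Pi.zero_apply] at h0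
    exact one_ne_zero h0
  obtain ⟨c₀, L₀, hc₀, hlow⟩ := (hvar f₀M hf₀Mc hf₀Ms).2 hf₀Mnn hf₀Mne
  -- the good `δ`
  have hgood : ∀ᶠ δ in 𝓝[>] (0 : ℝ), 0 < δ ∧ W (J δ) (L δ) ∧ 1 < L δ ∧ L₀ ≤ L δ := by
    filter_upwards [hδpos, hW', hLtop.eventually (eventually_gt_atTop 1),
      hLtop.eventually (eventually_ge_atTop L₀)] with δ h1 h2 h3 h4
    exact ⟨h1, h2, h3, h4⟩
  -- at a good `δ`: `Σ_L^{1/2} ≠ 0`, and the full lattice sum is `a(δ) T_{f_M, L}`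
  have hS : ∀ δ, 0 < δ → L₀ ≤ L δ → Real.sqrt (phi4BlockVariance d g κ (J δ) (L δ)) ≠ 0 := by
    intro δ hδ hL0 h0
    obtain ⟨v₀, hv₀, hcv₀⟩ := hlow (J δ) (L δ) (hJ δ hδ).1 (hJ δ hδ).2 hL0
    have := eq_zero_of_hasBoxLimit_sq_of_sqrt_eq_zero h0 hv₀
    linarith
  have hfull : ∀ δ, 0 < δ → L₀ ≤ L δ → ∀ {f : EuclideanSpace ℝ (Fin d) → ℝ} {r : ℝ},
      (∀ x, f x ≠ 0 → ∀ i, |x i| ≤ r) → ∀ φ : LSite d → ℝ,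
      ρ δ * δ ^ d * ∑ x ∈ latticeBox d (r / |δ|), f (δ • siteToE x) * φ x =
        a δ * phi4NormalizedField d g κ (J δ) (L δ) (fun y => f (M⁻¹ • y)) φ := by
    intro δ hδ hL0 f r hf φ
    have hS' := hS δ hδ hL0
    rw [hL] at hS'
    rw [ha, hL]
    exact fullSum_eq_mul_phi4NormalizedField hM0.ne' hδ.ne' (ρ δ) hf hS' φ
  -- the identification at a good `δ`, for `f` Schwartz vanishing outside `[-r,r]ᵈ`,
  -- given the exponential-moment data of `hmgf` for the dilate `f(·/M)`
  have hident : ∀ δ, 0 < δ → W (J δ) (L δ) → 1 < L δ → L₀ ≤ L δ →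
      ∀ (f : 𝓢(EuclideanSpace ℝ (Fin d), ℝ)) (r : ℝ), (∀ x, f x ≠ 0 → ∀ i, |x i| ≤ r) →
      ∀ (A : ℝ) (k : ℝ → ℝ), (∀ (J' L' : ℝ), 0 ≤ J' → J' ≤ phi4CriticalJ d g κ → W J' L' →
        1 < L' → ∀ z : ℝ, ∃ m v v' : ℝ,
        HasBoxLimit (phi4BoxExpect d g κ J' fun φ =>
          Real.exp (z * phi4NormalizedField d g κ J' L' (fun y => f (M⁻¹ • y)) φ)) m ∧
        HasBoxLimit (phi4BoxExpect d g κ J' fun φ =>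
          phi4NormalizedField d g κ J' L' (fun y => f (M⁻¹ • y)) φ ^ 2) v ∧
        HasBoxLimit (phi4BoxExpect d g κ J' fun φ =>
          phi4NormalizedField d g κ J' L' (fun x => |f (M⁻¹ • x)|) φ ^ 2) v' ∧
        |m - Real.exp (z ^ 2 / 2 * v)| ≤ Real.exp (z ^ 2 / 2 * v') * (A * z ^ 4 * k L')) →
      ∀ w : ℝ, ∃ m v v' : ℝ,
        (Integrable (fun ω : FieldConfig (EuclideanSpace ℝ (Fin d)) => Real.exp (w * ω f)) (ν δ) ∧
          ∫ ω, Real.exp (w * ω f) ∂ν δ = m) ∧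
        (HasBoxLimit (phi4BoxExpect d g κ (J δ) fun φ =>
          phi4NormalizedField d g κ (J δ) (L δ) (fun x => f (M⁻¹ • x)) φ ^ 2) v ∧
          ∫ ω, (ω f) ^ 2 ∂ν δ = a δ ^ 2 * v) ∧
        HasBoxLimit (phi4BoxExpect d g κ (J δ) fun φ =>
          phi4NormalizedField d g κ (J δ) (L δ) (fun x => |f (M⁻¹ • x)|) φ ^ 2) v' ∧
        |m - Real.exp ((a δ * w) ^ 2 / 2 * v)| ≤ Real.exp ((a δ * w) ^ 2 / 2 * v') *
          (A * (a δ * w) ^ 4 * k (L δ)) := by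
    intro δ hδ hWδ hL1 hL0 f r hfr A k Hf w
    set fM : EuclideanSpace ℝ (Fin d) → ℝ := fun y => f (M⁻¹ • y) with hfM
    have Hf' := Hf (J δ) (L δ) (hJ δ hδ).1 (hJ δ hδ).2 hWδ hL1
    have Hz : ∀ z : ℝ, ∃ m : ℝ, HasBoxLimit (phi4BoxExpect d g κ (J δ) fun φ =>
        Real.exp (z * phi4NormalizedField d g κ (J δ) (L δ) fM φ)) m := fun z => by
      obtain ⟨m, v, v', hm, -, -, -⟩ := Hf' z
      exact ⟨m, hm⟩
    choose mT hmT using Hz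
    have hexp : ∀ t : ℝ, Integrable (fun ω : FieldConfig (EuclideanSpace ℝ (Fin d)) =>
        Real.exp (t * ω f)) (ν δ) ∧ ∫ ω, Real.exp (t * ω f) ∂ν δ = mT (t * a δ) := by
      intro t
      refine integral_exp_eval_eq_of_thermodynamicLimit hg hδ.ne' (hν δ hδ) hfr
        (m := fun t => mT (t * a δ)) (fun t' => ?_) t
      have h := (hasBoxLimit_phi4BoxExpect_iff.1 (hmT (t' * a δ)))
      refine h.congr' (Eventually.of_forall fun R => integral_congr_ae
        (Eventually.of_forall fun φ => ?_))
      simp only [hfull δ hδ hL0 hfr φ, mul_assoc, hfM]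
    obtain ⟨m, v, v', hm, hv, hv', hbd⟩ := Hf' (a δ * w)
    refine ⟨m, v, v', ?_, ⟨hv, ?_⟩, hv', hbd⟩
    · have h1 := hexp w
      have h2 : mT (w * a δ) = m := by
        refine tendsto_nhds_unique (hmT (w * a δ)) ?_
        rw [mul_comm w (a δ)]
        exact hm
      exact ⟨h1.1, h1.2.trans h2⟩
    · refine (integral_sq_eval_eq_of_thermodynamicLimit hg hδ.ne' (hν δ hδ) hfr
        (V := a δ ^ 2 * v) (m₁ := mT (1 * a δ)) (m₂ := mT ((-1) * a δ)) ?_ ?_ ?_).2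
      · have h := (hasBoxLimit_phi4BoxExpect_iff.1 hv).const_mul (a δ ^ 2)
        refine h.congr' (Eventually.of_forall fun R => ?_)
        rw [← integral_const_mul]
        refine integral_congr_ae (Eventually.of_forall fun φ => ?_)
        simp only [hfull δ hδ hL0 hfr φ, mul_pow, hfM]
      · have h := (hasBoxLimit_phi4BoxExpect_iff.1 (hmT (1 * a δ)))
        refine h.congr' (Eventually.of_forall fun R => integral_congr_ae
          (Eventually.of_forall fun φ => ?_))
        simp only [hfull δ hδ hL0 hfr φ, mul_assoc, hfM]
      · have h := (hasBoxLimit_phi4BoxExpect_iff.1 (hmT ((-1) * a δ)))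
        refine h.congr' (Eventually.of_forall fun R => integral_congr_ae
          (Eventually.of_forall fun φ => ?_))
        simp only [hfull δ hδ hL0 hfr φ, mul_assoc, hfM]
  -- the data
  refine ⟨fun δ => a δ ^ 2, Eventually.of_forall fun δ => sq_nonneg _, ?_, ?_⟩
  · -- (i) the lower variance bound for the bump `f₀`
    obtain ⟨A₀, k₀, -, H₀⟩ := hmgf (M * 2) (by nlinarith) f₀M hf₀Mc hf₀Mcube
    refine ⟨f₀, c₀, hf₀s, hc₀, ?_⟩
    filter_upwards [hgood] with δ ⟨hδ, hWδ, hL1, hL0⟩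
    obtain ⟨m, v, v', -, ⟨hvlim, hv⟩, -, -⟩ := hident δ hδ hWδ hL1 hL0 f₀ 2 hf₀cube A₀ k₀ H₀ 0
    obtain ⟨v₀, hv₀, hcv₀⟩ := hlow (J δ) (L δ) (hJ δ hδ).1 (hJ δ hδ).2 hL0
    have hvv : v = v₀ := tendsto_nhds_unique hvlim hv₀
    rw [hv, hvv, mul_comm]
    exact mul_le_mul_of_nonneg_left hcv₀ (sq_nonneg _)
  · -- (ii) the scale-covariant exponential-moment bound
    intro f hfc
    obtain ⟨r, hr1, hfr⟩ := exists_cube_of_hasCompactSupport f hfc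
    set fM : EuclideanSpace ℝ (Fin d) → ℝ := fun y => f (M⁻¹ • y) with hfM
    have hfMc : Continuous fM := continuous_dilate f.continuous M
    have hfMs : HasCompactSupport fM := hasCompactSupport_dilate hfc hM0.ne'
    have hfMcube : ∀ x, fM x ≠ 0 → ∀ i, |x i| ≤ M * r := cube_of_comp_inv_smul hfr hM0
    obtain ⟨A, k, hk, Hf⟩ := hmgf (M * r) (one_le_mul_of_one_le_of_one_le hM1 hr1) fM hfMc hfMcube
    obtain ⟨Cabs, hCabs⟩ := (hvar (fun x => |fM x|) hfMc.abs
      (hfMs.comp_left (g := fun t : ℝ => |t|) abs_zero)).1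
    set C' : ℝ := max Cabs 0 with hC'
    set K : ℝ → ℝ := fun δ => |A * k (L δ)| with hK
    set G : ℝ → ℝ := fun t => t ^ 2 * Real.exp (C' * t / 2) with hG
    refine ⟨K, G, ?_, ?_, ?_, ?_⟩
    · -- `K(δ) → 0`
      have h1 : Tendsto (fun δ => A * k (L δ)) (𝓝[>] (0 : ℝ)) (𝓝 0) := by
        simpa using (hk.comp hLtop).const_mul A
      show Tendsto (fun δ => |A * k (L δ)|) (𝓝[>] (0 : ℝ)) (𝓝 0)
      simpa only [abs_zero] using h1.abs
    · -- `G` is monotone on `[0, ∞)`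
      intro s hs t _ hst
      have hs0 : 0 ≤ s := hs
      have hC'0 : 0 ≤ C' := le_max_right _ _
      exact mul_le_mul (pow_le_pow_left₀ hs0 hst 2)
        (Real.exp_le_exp.2 (by nlinarith)) (Real.exp_pos _).le (sq_nonneg t)
    · -- exponential moments exist
      filter_upwards [hgood] with δ ⟨hδ, hWδ, hL1, hL0⟩ w
      obtain ⟨m, v, v', hm, -, -, -⟩ := hident δ hδ hWδ hL1 hL0 f r hfr A k Hf w
      exact hm.1
    · -- the bound
      filter_upwards [hgood] with δ ⟨hδ, hWδ, hL1, hL0⟩ w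
      obtain ⟨m, v, v', hm, ⟨-, hv⟩, hv', hbd⟩ := hident δ hδ hWδ hL1 hL0 f r hfr A k Hf w
      obtain ⟨v'', hv'', hv''C⟩ := hCabs (J δ) (L δ) (hJ δ hδ).1 (hJ δ hδ).2 hL1.le
      have hvv : v' = v'' := tendsto_nhds_unique hv' hv''
      have hv'C : v' ≤ C' := (hvv.le.trans hv''C).trans (le_max_left _ _)
      rw [hm.2, hv]
      have hlhs : Real.exp (w ^ 2 * (a δ ^ 2 * v) / 2) = Real.exp ((a δ * w) ^ 2 / 2 * v) := by
        congr 1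
        ring
      rw [hlhs]
      refine hbd.trans ?_
      have hexpC : Real.exp ((a δ * w) ^ 2 / 2 * v') ≤ Real.exp (C' * (a δ ^ 2 * w ^ 2) / 2) := by
        refine Real.exp_le_exp.2 ?_
        have h0 : 0 ≤ (a δ * w) ^ 2 / 2 := by positivity
        calc (a δ * w) ^ 2 / 2 * v' ≤ (a δ * w) ^ 2 / 2 * C' :=
            mul_le_mul_of_nonneg_left hv'C h0
          _ = C' * (a δ ^ 2 * w ^ 2) / 2 := by ring
      have hP : A * (a δ * w) ^ 4 * k (L δ) ≤ K δ * (a δ ^ 2 * w ^ 2) ^ 2 := by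
        calc A * (a δ * w) ^ 4 * k (L δ) = (A * k (L δ)) * (a δ ^ 2 * w ^ 2) ^ 2 := by ring
          _ ≤ |A * k (L δ)| * (a δ ^ 2 * w ^ 2) ^ 2 :=
              mul_le_mul_of_nonneg_right (le_abs_self _) (sq_nonneg _)
          _ = K δ * (a δ ^ 2 * w ^ 2) ^ 2 := by simp only [hK]
      -- the printed right-hand side is non-negative (it dominates an absolute value)
      have hPnn : 0 ≤ A * (a δ * w) ^ 4 * k (L δ) := by
        have h := (abs_nonneg _).trans hbd
        exact nonneg_of_mul_nonneg_right (by rwa [mul_comm] at h) (Real.exp_pos _)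
      calc Real.exp ((a δ * w) ^ 2 / 2 * v') * (A * (a δ * w) ^ 4 * k (L δ))
          ≤ Real.exp (C' * (a δ ^ 2 * w ^ 2) / 2) * (K δ * (a δ ^ 2 * w ^ 2) ^ 2) :=
            mul_le_mul hexpC hP hPnn (Real.exp_pos _).le
        _ = K δ * G (a δ ^ 2 * w ^ 2) := by
            simp only [hG]
            ring

/-! ### constructive-qft.S24, `d ≥ 5`: `phi4_highDim_triviality` from Panis's Theorem 5.5 -/

/-- **`phi4_highDim_triviality` (`d ≥ 5`; Aizenman 1982 Prop. 10.1, Fröhlich 1982; Panis 2023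
Thm 5.5 with Rem. 5.7) from the printed inputs at the level of the printed objects.** For each
`d ≥ 5`, `g > 0`, `κ`, the hypotheses transcribe, for the free-boundary infinite-volume lattice
`φ⁴` state on `ℤᵈ` (box limits of `phi4BoxMeasure` expectations) and
`T_{f,L} = Σ_L^{-1/2} ∑_x f(x/L) φ_x` (`phi4NormalizedField`):

* `h55` — **Panis 2023, Thm 5.5** (arXiv:2309.05797 numbering; extended to the Griffiths–Simon
  class, which contains lattice `φ⁴` by Prop. 2.2, in Rem. 5.7 and §8; nearest-neighbour model,
  `η = 0`, `d_eff = d > 4`; the `d > 4` triviality theorem is originally Aizenman, CMP 86 (1982),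
  Prop. 10.1 / §13, and Fröhlich, NPB 200 (1982), in correlation-function form): there are
  `C, γ > 0` with, for all `0 < J ≤ J_c(g,κ)` (print: "for all `β ≤ β_c`" with the constant
  `C (β⁻⁴ ∨ β⁻²)`), `L ≥ 1`, `r ≥ 1`, continuous `f` vanishing outside `[-r, r]ᵈ` and real `z`,
  the infinite-volume limits `m = ⟨e^{zT_{f,L}}⟩`, `v = ⟨T²_{f,L}⟩`, `v' = ⟨T²_{|f|,L}⟩` exist and
  `|m - e^{z² v/2}| ≤ e^{z² v'/2} · C (J⁻⁴ ∨ J⁻²) ‖f‖_∞⁴ r^γ z⁴ / L^{d-4}`;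
* `hvar` — the **variance bounds** (Panis §1.2.1, footnote 3: "for `f ≠ 0`, one has
  `0 < c_f ≤ ⟨T_{f,L,β}²⟩_β ≤ C_f < ∞`"; ADC 2021 p. 6): `⟨T²_{f,L}⟩ ≤ C_f` for `J ≤ J_c`,
  `L ≥ 1`, and, for `f ≥ 0`, `f ≢ 0`, `⟨T²_{f,L}⟩ ≥ c_f > 0` for `J ≤ J_c`, `L ≥ L₀(f)`.

**Conclusion**: the tree's named fact `phi4_highDim_triviality` (restated form: thermodynamic
limit first, couplings `J(δ) ≥ J₀ > 0` eventually). *Proof*: `exists_scale_of_mgfBound` with the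
window predicate `W J L := (J₀ ≤ J)`, `M = 1`, rate `k(L) = L^{-(d-4)} → 0` and constant
`A = C (J₀⁻⁴ ∨ J₀⁻²) ‖f‖_∞⁴ r^γ` (the printed constant is non-increasing in `J ≥ J₀`), then
`phi4_highDim_triviality_of_scaleBound`. What is left to vendor is the printed lattice-`φ⁴`
substance (Panis Thm 5.5 via Prop. 2.2, Prop. 3.8, the sliding-scale infrared bound; Aizenman
§11–13) and the variance bounds, for the free-boundary infinite-volume state.
[cite: Panis2023Triviality, Thm. 5.5 with Rem. 5.7, §1.2.1 fn. 3] [cite: AizenmanCMP1982, Prop. 10.1 (p. 28) and §13 (pp. 39–41)] -/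
theorem phi4_highDim_triviality_of_thm55
    (h55 : ∀ (d : ℕ), 5 ≤ d → ∀ (g κ : ℝ), 0 < g → ∃ C γ : ℝ, 0 < C ∧ 0 < γ ∧
      ∀ (J L r : ℝ), 0 < J → J ≤ phi4CriticalJ d g κ → 1 ≤ L → 1 ≤ r →
      ∀ f : EuclideanSpace ℝ (Fin d) → ℝ, Continuous f → (∀ x, f x ≠ 0 → ∀ i, |x i| ≤ r) →
      ∀ z : ℝ, ∃ m v v' : ℝ,
        HasBoxLimit (phi4BoxExpect d g κ J fun φ =>
          Real.exp (z * phi4NormalizedField d g κ J L f φ)) m ∧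
        HasBoxLimit (phi4BoxExpect d g κ J fun φ => phi4NormalizedField d g κ J L f φ ^ 2) v ∧
        HasBoxLimit (phi4BoxExpect d g κ J fun φ =>
          phi4NormalizedField d g κ J L (fun x => |f x|) φ ^ 2) v' ∧
        |m - Real.exp (z ^ 2 / 2 * v)| ≤ Real.exp (z ^ 2 / 2 * v') *
          (C * max (J ^ (-4 : ℤ)) (J ^ (-2 : ℤ)) * (⨆ x, |f x|) ^ 4 * r ^ γ * z ^ 4 /
            L ^ (d - 4)))
    (hvar : ∀ (d : ℕ), 5 ≤ d → ∀ (g κ : ℝ), 0 < g → ∀ f : EuclideanSpace ℝ (Fin d) → ℝ,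
      Continuous f → HasCompactSupport f →
      (∃ C : ℝ, ∀ (J L : ℝ), 0 ≤ J → J ≤ phi4CriticalJ d g κ → 1 ≤ L →
        ∃ v : ℝ, HasBoxLimit (phi4BoxExpect d g κ J fun φ =>
          phi4NormalizedField d g κ J L f φ ^ 2) v ∧ v ≤ C) ∧
      ((∀ x, 0 ≤ f x) → f ≠ 0 → ∃ c L₀ : ℝ, 0 < c ∧
        ∀ (J L : ℝ), 0 ≤ J → J ≤ phi4CriticalJ d g κ → L₀ ≤ L →
        ∃ v : ℝ, HasBoxLimit (phi4BoxExpect d g κ J fun φ =>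
          phi4NormalizedField d g κ J L f φ ^ 2) v ∧ c ≤ v)) :
    phi4_highDim_triviality := by
  refine phi4_highDim_triviality_of_scaleBound fun d hd g κ hg J ρ ν hJ hJ₀ hν => ?_
  obtain ⟨J₀, hJ₀pos, hJ₀⟩ := hJ₀
  obtain ⟨C, γ, hC, hγ, H⟩ := h55 d hd g κ hg
  refine exists_scale_of_mgfBound (d := d) hg hJ hν (W := fun J' _ => J₀ ≤ J') (M := 1) le_rfl
    (by simpa only using hJ₀) (fun r hr1 f hfc hfr => ?_) (hvar d hd g κ hg)
  -- Panis's constant is non-increasing in `J ≥ J₀`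
  set B : ℝ := max (J₀ ^ (-4 : ℤ)) (J₀ ^ (-2 : ℤ)) with hB
  refine ⟨C * B * (⨆ x, |f x|) ^ 4 * r ^ γ, fun L => (L ^ (d - 4))⁻¹, ?_, ?_⟩
  · have hd4 : d - 4 ≠ 0 := by omega
    exact tendsto_inv_atTop_zero.comp (tendsto_pow_atTop hd4)
  · intro J' L hJ'0 hJ'c hJ₀J' hL1 z
    have hJ'pos : 0 < J' := hJ₀pos.trans_le hJ₀J'
    obtain ⟨m, v, v', hm, hv, hv', hbd⟩ := H J' L r hJ'pos hJ'c hL1.le hr1 f hfc hfr z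
    refine ⟨m, v, v', hm, hv, hv', hbd.trans (mul_le_mul_of_nonneg_left ?_ (Real.exp_pos _).le)⟩
    have hz : ∀ n : ℕ, J' ^ (-(n : ℤ)) ≤ J₀ ^ (-(n : ℤ)) := fun n => by
      rw [zpow_neg, zpow_neg, zpow_natCast, zpow_natCast]
      exact inv_anti₀ (pow_pos hJ₀pos n) (pow_le_pow_left₀ hJ₀pos.le hJ₀J' n)
    have hmax : max (J' ^ (-4 : ℤ)) (J' ^ (-2 : ℤ)) ≤ B := max_le_max (hz 4) (hz 2)
    rw [div_eq_mul_inv]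
    have h1 : 0 ≤ C * (⨆ x, |f x|) ^ 4 * r ^ γ * z ^ 4 * (L ^ (d - 4))⁻¹ := by
      have : 0 ≤ r ^ γ := Real.rpow_nonneg (zero_le_one.trans hr1) γ
      have : 0 < L ^ (d - 4) := pow_pos (one_pos.trans hL1) _
      positivity
    calc C * max (J' ^ (-4 : ℤ)) (J' ^ (-2 : ℤ)) * (⨆ x, |f x|) ^ 4 * r ^ γ * z ^ 4 * (L ^ (d - 4))⁻¹
        = max (J' ^ (-4 : ℤ)) (J' ^ (-2 : ℤ)) * (C * (⨆ x, |f x|) ^ 4 * r ^ γ * z ^ 4 *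
            (L ^ (d - 4))⁻¹) := by ring
      _ ≤ B * (C * (⨆ x, |f x|) ^ 4 * r ^ γ * z ^ 4 * (L ^ (d - 4))⁻¹) :=
          mul_le_mul_of_nonneg_right hmax h1
      _ = C * B * (⨆ x, |f x|) ^ 4 * r ^ γ * z ^ 4 * (L ^ (d - 4))⁻¹ := by ring

/-! ### constructive-qft.S24, Ising case: `ising4_triviality` from ADC Theorem 1.3 / Panis Cor. 1.8 -/

/-- **`ising4_triviality` from the correlation-length-window Ursell-sum bound of ADC §6.3**
(`Literature.Probability.LatticeModels.aizenmanDuminilCopin_ursellFourSum_le`: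
`Σ_L⁻² ∑_{Λ_{rL}⁴} |U₄| ≤ C r¹² (log L)^{-c}` for `d = 4`, `β = β_c` or `1 < L ≤ ξ(β)`). The tree's
law-level theorem `isGaussianField_of_tendstoInLaw_spinFieldLaw_gibbs` (crit-ising.S13 corrected,
`FieldScalingLimitTrivialityProofs`) is `ising4_triviality` without its window hypothesis and
without the a-posteriori `HasBoundedNondegenerateTwoPoint μ`; its uniform-smallness input is
`ursellFourSum_uniformlySmall_of_adc`. [cite: AizenmanDuminilCopinAnnals2021, Thm 1.2 (p. 4) with §1.3 (p. 5), Prop. 1.4 (p. 6), §6.3 (pp. 26–27)] -/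
theorem ising4_triviality_of_adcUrsellFourSum (hS₄ : aizenmanDuminilCopin_ursellFourSum_le) :
    ising4_triviality := fun _β _ν _L _ρ _μ hβ hν _ hL hlim _ =>
  isGaussianField_of_tendstoInLaw_spinFieldLaw_gibbs le_rfl
    (ursellFourSum_uniformlySmall_of_adc hS₄ le_rfl) hβ hν hL hlim

/-- **`ising4_triviality` from Aizenman–Duminil-Copin 2021, Theorem 1.3 alone** (the improved
tree diagram bound `Literature.Probability.LatticeModels.aizenmanDuminilCopin_improvedTreeDiagramBound`,
the one named fact left in the trust base: the §6.3 summation is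
`aizenmanDuminilCopin_ursellFourSum_le_of_facts` with the sliding-scale infrared bound Thm 5.6
proved, `aizenmanDuminilCopin_slidingScaleInfraredBound_holds`). The discharge
`ising4_triviality_holds` is this theorem applied to `aizenmanDuminilCopin_improvedTreeDiagramBound_holds`
once Theorem 1.3 is proved. [cite: AizenmanDuminilCopinAnnals2021, Thm 1.2 (p. 4), Thm 1.3 (p. 6), Thm 5.6 (p. 18), §6.3 (pp. 26–27)] -/
theorem ising4_triviality_of_improvedTreeDiagramBound
    (h13 : aizenmanDuminilCopin_improvedTreeDiagramBound) : ising4_triviality :=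
  ising4_triviality_of_adcUrsellFourSum
    (aizenmanDuminilCopin_ursellFourSum_le_of_facts h13
      aizenmanDuminilCopin_slidingScaleInfraredBound_holds)

/-- **`ising4_triviality` from Panis 2023, Cor. 1.8 alone** (the sharp-length-window form of the
`d = 4` logarithmic improvement, `Literature.Probability.LatticeModels.panis_ursellFourSum_le_four`),
through `ursellFourSum_uniformlySmall_of_panis_four`. [cite: Panis2023Triviality, Cor. 1.8 and Thm. 1.2] -/
theorem ising4_triviality_of_panisFour (hP₄ : panis_ursellFourSum_le_four) : ising4_triviality :=
  fun _β _ν _L _ρ _μ hβ hν _ hL hlim _ =>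
    isGaussianField_of_tendstoInLaw_spinFieldLaw_gibbs le_rfl
      (fun r hr ε hε => ursellFourSum_uniformlySmall_of_panis_four hP₄ le_rfl r hr ε hε) hβ hν hL hlim

end Literature.MathematicalPhysics.QuantumFieldTheory

end
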